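import Literature.Probability.Percolation.ArmQuasiMultNormalForm
import Literature.Probability.Percolation.ArmEventsBoundedRatio
import Literature.Probability.Percolation.FiveArmExponentFacts
import HarnessLib

/-!
# `Nolin2008_prop17_quasiMult` reduced to its well-spaced case

Topic: Probability / Percolation; family `crit-perc` (critical site percolation `P = P_{1/2}` on
`𝕋`; the order-free arm probabilities `polyArmProb κ n N` of `ArmEvents.lean`). A reduction of the
named fact `Literature.Probability.Percolation.Nolin2008_prop17_quasiMult`
(`FiveArmExponentFacts.lean`; P. Nolin, *Near-critical percolation in two dimensions*, EJP 13
(2008), §4.5 Prop. 17 [arXiv 0711.4948: Prop. 16], quasi-multiplicativity, gluing half, for every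
number of arms and every colour sequence) to its content proper: quasi-multiplicativity along
WELL-SPACED radii `A n₁ ≤ n₂`, `A n₂ ≤ n₃` for each colour sequence (any fixed ratio `A ≥ 2`). The
first sentence of Nolin's proof, "We may assume that `n₂ ≥ 8 n₁`", is thereby discharged for ALL
`(k, κ)`: the bounded-ratio cases only use the RSW positivity of the `k`-arm probability at bounded
ratio (`exists_le_polyArmProb_of_le_mul_any`, `ArmEventsBoundedRatio.lean`, every `k`) and the
monotonicity of `π` in both radii (`polyArmProb_quasiMult_of_spaced`, `ArmQuasiMultNormalForm.lean`).
Everything here is PROVED; no definition and no named fact is introduced.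

* `polyArmProb_quasiMult_of_spaced_any` — for one colour sequence `κ : Fin k → Bool`, any `k`;
* `Nolin2008_prop17_quasiMult_of_spaced` — **the named fact from its well-spaced case for every
  colour sequence.** What remains (the well-spaced case for `(k, κ) ∉ {k ≤ 1} ∪ {(2, TF), (2, FT)}`,
  cf. `polyArmProb_quasiMult_of_le_one`, `polyArmProb_quasiMult_two_of_ne`) is Nolin's arm
  separation (Thm. 11 [arXiv Thm. 10]) and the gluing of separated arms (Prop. 12 [arXiv Prop. 11])
  for the corresponding pattern.

## References

* P. Nolin, *Near-critical percolation in two dimensions*, Electron. J. Probab. 13 (2008),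
  1562–1623, §4.5 Prop. 17, proof, first sentence; §4.1 item 3; Prop. 14 [arXiv 0711.4948:
  Prop. 16, Prop. 13]. [Nolin2008]

Tree: `polyArmProb_quasiMult_of_spaced'` (`ArmQuasiMultNormalForm.lean`),
`exists_le_polyArmProb_of_le_mul_any` (`ArmEventsBoundedRatio.lean`), `Nolin2008_prop17_quasiMult`
(`FiveArmExponentFacts.lean`).
-/

noncomputable section

namespace Literature.Probability.Percolation

open LatticeModels

/-- **Quasi-multiplicativity for one colour sequence from its well-spaced case** (Nolin 2008, proof
of Prop. 17 [arXiv 0711.4948: Prop. 16], "We may assume that `n₂ ≥ 8 n₁`", for ANY number of arms):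
if for some ratio `A ≥ 2` there are `c > 0`, `n₀` with `c · π(n₁,n₂) π(n₂,n₃) ≤ π(n₁,n₃)` whenever
`n₀ ≤ n₁`, `A n₁ ≤ n₂`, `A n₂ ≤ n₃`, then the same holds (other constants) for all
`n₀' ≤ n₁ < n₂ < n₃` (`π = polyArmProb κ`): the normal form `polyArmProb_quasiMult_of_spaced'` with
the bounded-ratio positivity `exists_le_polyArmProb_of_le_mul_any` at ratio `A²`. [cite: Nolin2008, §4.5 Prop. 17, proof (arXiv 0711.4948: Prop. 16)] -/
theorem polyArmProb_quasiMult_of_spaced_any {k : ℕ} (κ : Fin k → Bool) {A : ℕ} (hA : 2 ≤ A)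
    (hsp : ∃ c : ℝ, 0 < c ∧ ∃ n₀ : ℕ, ∀ n₁ n₂ n₃ : ℕ, n₀ ≤ n₁ → A * n₁ ≤ n₂ → A * n₂ ≤ n₃ →
      c * (polyArmProb κ n₁ n₂ * polyArmProb κ n₂ n₃) ≤ polyArmProb κ n₁ n₃) :
    ∃ c : ℝ, 0 < c ∧ ∃ n₀ : ℕ, ∀ n₁ n₂ n₃ : ℕ, n₀ ≤ n₁ → n₁ < n₂ → n₂ < n₃ →
      c * (polyArmProb κ n₁ n₂ * polyArmProb κ n₂ n₃) ≤ polyArmProb κ n₁ n₃ := by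
  refine polyArmProb_quasiMult_of_spaced' κ hA ?_ hsp
  obtain ⟨a, ha, h⟩ := exists_le_polyArmProb_of_le_mul_any κ (A * A) (le_trans (by norm_num) (Nat.mul_le_mul hA hA))
  exact ⟨a, ha, 2 * (k + 1), fun m N hm hmN hN => h m N hm hmN (by rw [Nat.mul_assoc]; exact hN)⟩

/-- **`Nolin2008_prop17_quasiMult` from its well-spaced case** (Nolin 2008, Prop. 17 [arXiv
0711.4948: Prop. 16]): if for every `k` and every `κ : Fin k → Bool` there are a ratio `A ≥ 2`,
`c > 0` and `n₀` with `c · π(n₁,n₂) π(n₂,n₃) ≤ π(n₁,n₃)` for `n₀ ≤ n₁`, `A n₁ ≤ n₂`, `A n₂ ≤ n₃`, then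
the named fact holds. The hypothesis is the well-separatedness-and-gluing content of Prop. 17
(Thm. 11, Prop. 12); it is proved in the tree for `k ≤ 1` (`polyArmProb_one_quasiMult_spaced`) and
for the two polychromatic sequences of `k = 2` (`critTwoArmProb_quasiMult_spaced` with
`Nolin2008_twoArm_separation_holds`). [cite: Nolin2008, §4.5 Prop. 17 (arXiv 0711.4948: Prop. 16)] -/
theorem Nolin2008_prop17_quasiMult_of_spaced
    (h : ∀ {k : ℕ} (κ : Fin k → Bool), ∃ A : ℕ, 2 ≤ A ∧ ∃ c : ℝ, 0 < c ∧ ∃ n₀ : ℕ, ∀ n₁ n₂ n₃ : ℕ,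
      n₀ ≤ n₁ → A * n₁ ≤ n₂ → A * n₂ ≤ n₃ →
        c * (polyArmProb κ n₁ n₂ * polyArmProb κ n₂ n₃) ≤ polyArmProb κ n₁ n₃) :
    Nolin2008_prop17_quasiMult := by
  intro k κ
  obtain ⟨A, hA, hsp⟩ := h κ
  exact polyArmProb_quasiMult_of_spaced_any κ hA hsp

end Literature.Probability.Percolation

end
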